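import Literature.Claims.NS.Schatz2025
import Literature.Analysis.FluidPDE.TwoAndAHalfDimensionalFlows
import Literature.Analysis.FluidPDE.ClassicalSuitableRegionEnergy
import Literature.Analysis.FluidPDE.ClassicalSolutionGalilean
import Literature.Analysis.FluidPDE.HeatKernelFwdSmooth
import Literature.Analysis.FluidPDE.NSQuasipotential
import Literature.Analysis.FluidPDE.SchefferTestFunction
import Literature.Analysis.UnboundedOperators.HeatKernelHeatEquation
import Literature.Analysis.FluidPDE.CylindricalIntegration
import Literature.Analysis.FluidPDE.SteadyNSLiouvilleVorticityTransfer
import Mathlib.Analysis.SpecialFunctions.Integrals.Basic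
import Mathlib.MeasureTheory.Measure.Lebesgue.VolumeOfBalls
import Mathlib.Analysis.Real.Pi.Bounds
import HarnessLib

/-!
# C171 `Schatz2025` — wind-jet refutation of the local face `Step_M1_local` — part 1/6: the planar heat kernel

Cell `ns-claims` (D-0090), row C171 `Schatz2025` (locator =
the LANDED skeleton `Literature.Claims.NS.Schatz2025`, text of record as cited in its module docstring). Records-grade ADDENDUM
object of ns-claims-refuter-5 g5 (chair 2026-08-27T18:19Z: records only; row #155 adjudicated at the consumed
head `Step_M1`). Target of the chain: the RECORDED local face
`Literature.Claims.NS.Schatz2025.Step_M1_local` (skeleton l.182; (M.1) p.42 l.2, l.36–38 «F(θr) ≤ κ F(r) + C θ³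
for every suitable weak solution on Q_r(z0)», constants `θ ∈ (0,1/8)`, `κ ∈ (0,1)`, `C ≥ 0` FIRST, then every
open region, every suitable weak solution, every centre and radius with `Q_{2r}(z0) ⊆ Q`).
Main theorem (last file of the chain): `Summit.NavierStokesRegularity.NavierStokesRegularity.Theorems.Schatz2025.not_Step_M1_local`.

THIS FILE (1/6): closed form and pointwise bounds of the planar heat kernel `K_τ(η) = (4πτ)⁻¹e^{-|η|²/4τ}`
(`heatKernel` of `HeatKernelHeatEquation.lean` on `ℝ²`): `K ≤ (4πτ)⁻¹`, `K ≤ (π|η|²)⁻¹`, the cube identity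
`K_τ³ = (48π²τ²)⁻¹ K_{τ/3}`, its total mass, Gaussian tail / disc mass bounds, measurability of the
zero-extended kernel `heatKernelFwd 1`; and the planar/solid integral geometry used later (`projXY` chords of
the unit ball, `lintegral` over a parabolic cylinder as a time-outer integral).

WHAT THIS IS NOT: not a claim about NS regularity or blow-up; not a claim about any author beyond the typed
locator.
-/

-- lint debt (cell convention, SoloRefute files): the Theorems namespace repeats `NavierStokesRegularity`.
set_option linter.dupNamespace false

noncomputable section

open Set Function MeasureTheory Filter TopologicalSpace Metric Real
open scoped Topology ContDiff ENNReal RealInnerProductSpace Laplacian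

namespace Summit.NavierStokesRegularity.NavierStokesRegularity.Theorems.Schatz2025

open Literature.Analysis.FluidPDE Literature.Analysis.UnboundedOperators

local notation "ℝ³" => EuclideanSpace ℝ (Fin 3)
local notation "ℝ²" => EuclideanSpace ℝ (Fin 2)

/-! ## The planar heat kernel: closed form, pointwise bounds -/

/-- Closed form of the planar heat kernel: `K_τ(η) = (4πτ)⁻¹ e^{-|η|²/(4τ)}` on `ℝ²`. [folklore] -/
theorem heatKernel_two (τ : ℝ) (η : ℝ²) :
    heatKernel τ η = (4 * π * τ)⁻¹ * exp (-‖η‖ ^ 2 / (4 * τ)) := by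
  rw [heatKernel, finrank_euclideanSpace_fin]
  have : (-((2 : ℕ) : ℝ) / 2) = -1 := by norm_num
  rw [this, Real.rpow_neg_one]

/-- `K_τ(η) ≤ (4πτ)⁻¹`. [folklore] -/
theorem heatKernel_le_inv_time {τ : ℝ} (hτ : 0 < τ) (η : ℝ²) : heatKernel τ η ≤ (4 * π * τ)⁻¹ := by
  rw [heatKernel_two]
  refine mul_le_of_le_one_right (by positivity) ?_
  rw [Real.exp_le_one_iff]
  have : 0 ≤ ‖η‖ ^ 2 / (4 * τ) := by positivity
  rw [neg_div]; linarith

/-- `K_τ(η) ≤ (π ‖η‖²)⁻¹` for `η ≠ 0`, all `τ > 0` (`e^{-s} ≤ 1/(1+s) ≤ 1/s`). [folklore] -/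
theorem heatKernel_le_inv_norm_sq {τ : ℝ} (hτ : 0 < τ) {η : ℝ²} (hη : η ≠ 0) :
    heatKernel τ η ≤ (π * ‖η‖ ^ 2)⁻¹ := by
  rw [heatKernel_two]
  have hn : 0 < ‖η‖ ^ 2 := by positivity
  set s : ℝ := ‖η‖ ^ 2 / (4 * τ) with hs
  have hs0 : 0 < s := by positivity
  have hexp : exp (-‖η‖ ^ 2 / (4 * τ)) ≤ s⁻¹ := by
    have h1 : s + 1 ≤ exp s := Real.add_one_le_exp s
    rw [show -‖η‖ ^ 2 / (4 * τ) = -s by rw [hs]; ring, Real.exp_neg]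
    calc (exp s)⁻¹ ≤ (s + 1)⁻¹ := inv_anti₀ (by positivity) h1
      _ ≤ s⁻¹ := inv_anti₀ hs0 (by linarith)
  calc (4 * π * τ)⁻¹ * exp (-‖η‖ ^ 2 / (4 * τ)) ≤ (4 * π * τ)⁻¹ * s⁻¹ :=
        mul_le_mul_of_nonneg_left hexp (by positivity)
    _ = (π * ‖η‖ ^ 2)⁻¹ := by rw [hs]; field_simp

/-- The cube of the planar heat kernel is a multiple of the kernel at one third of the time:
`K_τ³ = (48 π² τ²)⁻¹ K_{τ/3}`. [folklore] -/
theorem heatKernel_cube {τ : ℝ} (hτ : 0 < τ) (η : ℝ²) :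
    heatKernel τ η ^ 3 = (48 * π ^ 2 * τ ^ 2)⁻¹ * heatKernel (τ / 3) η := by
  rw [heatKernel_two, heatKernel_two, mul_pow, ← Real.exp_nat_mul]
  have h1 : ((3 : ℕ) : ℝ) * (-‖η‖ ^ 2 / (4 * τ)) = -‖η‖ ^ 2 / (4 * (τ / 3)) := by push_cast; ring
  rw [h1]
  have hπ : π ≠ 0 := Real.pi_pos.ne'
  have hτ' : τ ≠ 0 := hτ.ne'
  rw [← mul_assoc]
  congr 1
  field_simp
  ring

/-- `∫_{ℝ²} K_τ³ = (48 π² τ²)⁻¹`. [folklore] -/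
theorem integral_heatKernel_cube {τ : ℝ} (hτ : 0 < τ) :
    ∫ η : ℝ², heatKernel τ η ^ 3 = (48 * π ^ 2 * τ ^ 2)⁻¹ := by
  simp_rw [heatKernel_cube hτ, integral_const_mul,
    integral_heatKernel_eq_one_holds (E := ℝ²) (by positivity : 0 < τ / 3), mul_one]

/-- `K_τ³` is integrable on `ℝ²`. [folklore] -/
theorem integrable_heatKernel_cube {τ : ℝ} (hτ : 0 < τ) :
    Integrable (fun η : ℝ² => heatKernel τ η ^ 3) := by
  have h := (integrable_heatKernel_holds (E := ℝ²) (by positivity : 0 < τ / 3)).const_mul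
    (48 * π ^ 2 * τ ^ 2)⁻¹
  exact h.congr (Eventually.of_forall fun η => (heatKernel_cube hτ η).symm)

/-- Gaussian tail: outside the disc of radius `w` the kernel is at most `2 e^{-w²/(8s)} K_{2s}`. [folklore] -/
theorem heatKernel_le_tail {s w : ℝ} (hs : 0 < s) {η : ℝ²} (hη : w ≤ ‖η‖) (hw : 0 ≤ w) :
    heatKernel s η ≤ 2 * exp (-w ^ 2 / (8 * s)) * heatKernel (2 * s) η := by
  rw [heatKernel_two, heatKernel_two]
  have hsq : w ^ 2 ≤ ‖η‖ ^ 2 := pow_le_pow_left₀ hw hη 2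
  have key : exp (-‖η‖ ^ 2 / (4 * s)) ≤ exp (-w ^ 2 / (8 * s)) * exp (-‖η‖ ^ 2 / (4 * (2 * s))) := by
    rw [← Real.exp_add]
    apply Real.exp_le_exp.2
    have h1 : -‖η‖ ^ 2 / (4 * s) = -‖η‖ ^ 2 / (8 * s) + -‖η‖ ^ 2 / (4 * (2 * s)) := by ring
    rw [h1]
    have h2 : -‖η‖ ^ 2 / (8 * s) ≤ -w ^ 2 / (8 * s) :=
      div_le_div_of_nonneg_right (by linarith) (by positivity)
    linarith
  have hpos : 0 < (4 * π * s)⁻¹ := by positivity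
  calc (4 * π * s)⁻¹ * exp (-‖η‖ ^ 2 / (4 * s))
      ≤ (4 * π * s)⁻¹ * (exp (-w ^ 2 / (8 * s)) * exp (-‖η‖ ^ 2 / (4 * (2 * s)))) :=
        mul_le_mul_of_nonneg_left key hpos.le
    _ = 2 * exp (-w ^ 2 / (8 * s)) * ((4 * π * (2 * s))⁻¹ * exp (-‖η‖ ^ 2 / (4 * (2 * s)))) := by
        field_simp

/-- Mass of the kernel outside a disc: `∫_{|η| ≥ w} K_s ≤ 2 e^{-w²/(8s)}`. [folklore] -/
theorem integral_heatKernel_compl_ball_le {s w : ℝ} (hs : 0 < s) (hw : 0 ≤ w) :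
    ∫ η in (ball (0 : ℝ²) w)ᶜ, heatKernel s η ≤ 2 * exp (-w ^ 2 / (8 * s)) := by
  have h2s : 0 < 2 * s := by positivity
  have hint2 : Integrable (heatKernel (E := ℝ²) (2 * s)) := integrable_heatKernel_holds h2s
  calc ∫ η in (ball (0 : ℝ²) w)ᶜ, heatKernel s η
      ≤ ∫ η in (ball (0 : ℝ²) w)ᶜ, 2 * exp (-w ^ 2 / (8 * s)) * heatKernel (2 * s) η := by
        refine setIntegral_mono_on (integrable_heatKernel_holds hs).integrableOn
          (hint2.const_mul _).integrableOn measurableSet_ball.compl fun η hη => ?_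
        have : w ≤ ‖η‖ := by simpa [mem_ball, dist_zero_right] using hη
        exact heatKernel_le_tail hs this hw
    _ ≤ ∫ η, 2 * exp (-w ^ 2 / (8 * s)) * heatKernel (2 * s) η :=
        setIntegral_le_integral (hint2.const_mul _)
          (Eventually.of_forall fun η => by
            have := (heatKernel_pos h2s η).le
            positivity)
    _ = 2 * exp (-w ^ 2 / (8 * s)) := by
        rw [integral_const_mul, integral_heatKernel_eq_one_holds h2s, mul_one]

/-- Mass of the kernel inside a disc: `∫_{|η| < w} K_s ≥ 1 − 2 e^{-w²/(8s)}`. [folklore] -/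
theorem integral_heatKernel_ball_ge {s w : ℝ} (hs : 0 < s) (hw : 0 ≤ w) :
    1 - 2 * exp (-w ^ 2 / (8 * s)) ≤ ∫ η in ball (0 : ℝ²) w, heatKernel s η := by
  have hint : Integrable (heatKernel (E := ℝ²) s) := integrable_heatKernel_holds hs
  have hsplit := integral_add_compl (measurableSet_ball (x := (0 : ℝ²)) (ε := w)) hint
  rw [integral_heatKernel_eq_one_holds hs] at hsplit
  have htail := integral_heatKernel_compl_ball_le hs hw
  linarith

/-- **Cube mass in a disc**: `∫_{|η|<w} K_τ³ ≥ (48π²τ²)⁻¹ (1 − 2 e^{-3w²/(8τ)})`. [folklore] -/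
theorem integral_heatKernel_cube_ball_ge {τ w : ℝ} (hτ : 0 < τ) (hw : 0 ≤ w) :
    (48 * π ^ 2 * τ ^ 2)⁻¹ * (1 - 2 * exp (-(3 * w ^ 2) / (8 * τ))) ≤
      ∫ η in ball (0 : ℝ²) w, heatKernel τ η ^ 3 := by
  have hτ3 : 0 < τ / 3 := by positivity
  simp_rw [heatKernel_cube hτ, integral_const_mul]
  refine mul_le_mul_of_nonneg_left ?_ (by positivity)
  have h := integral_heatKernel_ball_ge hτ3 hw
  have he : -w ^ 2 / (8 * (τ / 3)) = -(3 * w ^ 2) / (8 * τ) := by field_simp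
  rwa [he] at h

/-- **Cube mass in any set** is at most the total: `∫_A K_τ³ ≤ (48π²τ²)⁻¹`. [folklore] -/
theorem setIntegral_heatKernel_cube_le {τ : ℝ} (hτ : 0 < τ) (A : Set ℝ²) :
    ∫ η in A, heatKernel τ η ^ 3 ≤ (48 * π ^ 2 * τ ^ 2)⁻¹ := by
  rw [← integral_heatKernel_cube hτ]
  exact setIntegral_le_integral (integrable_heatKernel_cube hτ)
    (Eventually.of_forall fun η => by have := (heatKernel_pos hτ η).le; positivity)

/-! ## The zero-extended kernel: measurability and the lintegral forms -/

/-- The zero-extended planar kernel `(τ, η) ↦ K_τ(η)` (zero for `τ ≤ 0`) is measurable. [folklore] -/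
theorem measurable_heatKernelFwd : Measurable (heatKernelFwd (E := ℝ²) 1) := by
  have h1 : Measurable fun w : ℝ × ℝ² => heatKernel (1 * w.1) w.2 := by
    unfold heatKernel; fun_prop
  refine Measurable.ite (measurableSet_lt measurable_const measurable_fst) h1 measurable_const

/-- The zero-extended planar kernel is nonnegative. [folklore] -/
theorem heatKernelFwd_nonneg' (w : ℝ × ℝ²) : 0 ≤ heatKernelFwd (E := ℝ²) 1 w := by
  by_cases h : 0 < w.1
  · rw [heatKernelFwd_of_pos 1 h]; exact (heatKernel_pos (by simpa using h) _).le
  · rw [heatKernelFwd_of_nonpos 1 (not_lt.1 h)]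



/-! ## C. Integral geometry of a thin column crossing a ball

Throughout, `H : ℝ² → ℝ≥0∞` is a measurable horizontal profile read through `π = projXY`. -/

/-- `‖x‖² = ‖x̃‖² + x₂²`. [folklore] -/
theorem norm_sq_eq_projXY (x : ℝ³) : ‖x‖ ^ 2 = ‖projXY x‖ ^ 2 + (x 2) ^ 2 := by
  rw [EuclideanSpace.norm_sq_eq, EuclideanSpace.norm_sq_eq, Fin.sum_univ_three, Fin.sum_univ_two]
  simp [Real.norm_eq_abs, sq_abs]

/-- The chord of the ball `B_ρ(0) ⊂ ℝ³` above the horizontal point `y`: `2 √(ρ² − |y|²)` (zero outside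
the disc, by `Real.sqrt` of a negative number). [folklore] -/
def chord (ρ : ℝ) (y : ℝ²) : ℝ := 2 * √(ρ ^ 2 - ‖y‖ ^ 2)

/-- The chord length is nonnegative. [folklore] -/
theorem chord_nonneg (ρ : ℝ) (y : ℝ²) : 0 ≤ chord ρ y := by unfold chord; positivity

/-- The chord length is measurable in the planar variable. [folklore] -/
theorem measurable_chord (ρ : ℝ) : Measurable (chord ρ) := by unfold chord; fun_prop

/-- `chord_ρ(y) ≤ 2ρ` for `ρ ≥ 0`. [folklore] -/
theorem chord_le {ρ : ℝ} (hρ : 0 ≤ ρ) (y : ℝ²) : chord ρ y ≤ 2 * ρ := by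
  unfold chord
  have : √(ρ ^ 2 - ‖y‖ ^ 2) ≤ √(ρ ^ 2) := Real.sqrt_le_sqrt (by nlinarith [norm_nonneg y])
  rw [Real.sqrt_sq hρ] at this
  linarith

/-- `chord_ρ` vanishes outside the disc. [folklore] -/
theorem chord_eq_zero {ρ : ℝ} {y : ℝ²} (h : ρ ≤ ‖y‖) (hρ : 0 ≤ ρ) : chord ρ y = 0 := by
  unfold chord
  rw [Real.sqrt_eq_zero'.2 (by nlinarith), mul_zero]

/-- `chord_ρ` is radially non-increasing: `‖y‖ ≤ m ⇒ chord_ρ(y) ≥ 2√(ρ² − m²)`. [folklore] -/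
theorem chord_ge_of_norm_le {ρ m : ℝ} {y : ℝ²} (h : ‖y‖ ≤ m) : 2 * √(ρ ^ 2 - m ^ 2) ≤ chord ρ y := by
  unfold chord
  have : √(ρ ^ 2 - m ^ 2) ≤ √(ρ ^ 2 - ‖y‖ ^ 2) :=
    Real.sqrt_le_sqrt (by nlinarith [norm_nonneg y])
  linarith

/-- … and `m ≤ ‖y‖`, `0 ≤ m` ⇒ `chord_ρ(y) ≤ 2√(ρ² − m²)`. [folklore] -/
theorem chord_le_of_le_norm {ρ m : ℝ} {y : ℝ²} (h : m ≤ ‖y‖) (hm : 0 ≤ m) :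
    chord ρ y ≤ 2 * √(ρ ^ 2 - m ^ 2) := by
  unfold chord
  have : √(ρ ^ 2 - ‖y‖ ^ 2) ≤ √(ρ ^ 2 - m ^ 2) := Real.sqrt_le_sqrt (by nlinarith)
  linarith

/-- The length of the vertical fibre `{z : z² < d}` is `2√d` (`= 0` for `d ≤ 0`). [folklore] -/
theorem volume_setOf_sq_lt (d : ℝ) : volume {z : ℝ | z ^ 2 < d} = ENNReal.ofReal (2 * √d) := by
  rcases le_or_gt d 0 with hd | hd
  · have h0 : {z : ℝ | z ^ 2 < d} = ∅ := by
      ext z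
      simp only [mem_setOf_eq, mem_empty_iff_false, iff_false, not_lt]
      exact hd.trans (sq_nonneg z)
    rw [h0, measure_empty, Real.sqrt_eq_zero'.2 hd, mul_zero, ENNReal.ofReal_zero]
  · have h1 : {z : ℝ | z ^ 2 < d} = Ioo (-√d) (√d) := by
      ext z
      simp only [mem_setOf_eq, mem_Ioo]
      exact Real.sq_lt
    rw [h1, Real.volume_Ioo]
    congr 1
    ring

/-- Membership in the ball through the cylindrical splitting. [folklore] -/
theorem mem_ball_iff_cylSplit {ρ : ℝ} (hρ : 0 < ρ) (x : ℝ³) :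
    x ∈ ball (0 : ℝ³) ρ ↔ (cylSplit x).1 ^ 2 < ρ ^ 2 - ‖(cylSplit x).2‖ ^ 2 := by
  rw [mem_ball_zero_iff, cylSplit_apply_fst, cylSplit_apply_snd]
  constructor
  · intro h
    have h2 : ‖x‖ ^ 2 < ρ ^ 2 := by nlinarith [norm_nonneg x]
    rw [norm_sq_eq_projXY] at h2
    linarith
  · intro h
    have h2 : ‖x‖ ^ 2 < ρ ^ 2 := by rw [norm_sq_eq_projXY]; linarith
    exact lt_of_pow_lt_pow_left₀ 2 hρ.le h2

/-- **Cylindrical Tonelli with chords**: `∫_{B_ρ} H(x̃) dx = ∫_{ℝ²} H(y) · chord_ρ(y) dy`. [folklore] -/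
theorem lintegral_ball_comp_projXY (H : ℝ² → ℝ≥0∞) (hH : Measurable H) {ρ : ℝ} (hρ : 0 < ρ) :
    ∫⁻ x in ball (0 : ℝ³) ρ, H (projXY x) = ∫⁻ y, H y * ENNReal.ofReal (chord ρ y) := by
  set S : Set (ℝ × ℝ²) := {p | p.1 ^ 2 < ρ ^ 2 - ‖p.2‖ ^ 2} with hS_def
  have hS : MeasurableSet S := measurableSet_lt (by fun_prop) (by fun_prop)
  set F : ℝ × ℝ² → ℝ≥0∞ := S.indicator fun p => H p.2 with hF
  have hFm : Measurable F := (hH.comp measurable_snd).indicator hS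
  have hind : ∀ x : ℝ³, (ball (0 : ℝ³) ρ).indicator (fun x => H (projXY x)) x = F (cylSplit x) := by
    intro x
    by_cases hx : x ∈ ball (0 : ℝ³) ρ
    · have hx' : cylSplit x ∈ S := (mem_ball_iff_cylSplit hρ x).1 hx
      rw [indicator_of_mem hx, hF, indicator_of_mem hx', cylSplit_apply_snd]
    · have hx' : cylSplit x ∉ S := fun h => hx ((mem_ball_iff_cylSplit hρ x).2 h)
      rw [indicator_of_notMem hx, hF, indicator_of_notMem hx']
  rw [← lintegral_indicator measurableSet_ball]
  simp_rw [hind]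
  rw [lintegral_comp_cylSplit F hFm]
  refine lintegral_congr fun y => ?_
  have hsec : ∀ k : ℝ, F (k, y) = {z : ℝ | z ^ 2 < ρ ^ 2 - ‖y‖ ^ 2}.indicator (fun _ => H y) k := by
    intro k
    by_cases hk : k ^ 2 < ρ ^ 2 - ‖y‖ ^ 2
    · have h1 : (k, y) ∈ S := hk
      rw [hF, indicator_of_mem h1, indicator_of_mem (by exact hk)]
    · have h1 : (k, y) ∉ S := hk
      rw [hF, indicator_of_notMem h1, indicator_of_notMem (by exact hk)]
  simp_rw [hsec]
  rw [lintegral_indicator_const (measurableSet_lt (by fun_prop) (by fun_prop)), volume_setOf_sq_lt]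
  rfl

/-- **Inner lower bound**: the ball integral dominates `2√(ρ² − (|c| + w)²) · ∫_{B(c,w)} H`. [folklore] -/
theorem lintegral_ball_comp_projXY_ge (H : ℝ² → ℝ≥0∞) (hH : Measurable H) {ρ w : ℝ} (hρ : 0 < ρ)
    (c : ℝ²) :
    ENNReal.ofReal (2 * √(ρ ^ 2 - (‖c‖ + w) ^ 2)) * (∫⁻ y in ball c w, H y) ≤
      ∫⁻ x in ball (0 : ℝ³) ρ, H (projXY x) := by
  rw [lintegral_ball_comp_projXY H hH hρ, ← lintegral_indicator measurableSet_ball,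
    ← lintegral_const_mul' _ _ ENNReal.ofReal_ne_top]
  refine lintegral_mono fun y => ?_
  by_cases hy : y ∈ ball c w
  · rw [indicator_of_mem hy, mul_comm]
    refine mul_le_mul' le_rfl (ENNReal.ofReal_le_ofReal (chord_ge_of_norm_le ?_))
    have : dist y c < w := hy
    calc ‖y‖ = ‖c + (y - c)‖ := by rw [add_sub_cancel]
      _ ≤ ‖c‖ + ‖y - c‖ := norm_add_le _ _
      _ ≤ ‖c‖ + w := by rw [← dist_eq_norm]; linarith
  · rw [indicator_of_notMem hy, mul_zero]
    exact bot_le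

/-- **Inner upper bound**: with `H ≤ B` off the disc `B(c, w)`,
`∫_{B_ρ} H(x̃) ≤ 2√(ρ² − ((|c| − w)₊)²) ∫_{B(c,w)} H + B · 2ρ · |B_ρ^{(2)}|`. [folklore] -/
theorem lintegral_ball_comp_projXY_le (H : ℝ² → ℝ≥0∞) (hH : Measurable H) {ρ w : ℝ} (hρ : 0 < ρ)
    (c : ℝ²) {B : ℝ≥0∞} (hB : ∀ y, y ∉ ball c w → H y ≤ B) :
    ∫⁻ x in ball (0 : ℝ³) ρ, H (projXY x) ≤
      ENNReal.ofReal (2 * √(ρ ^ 2 - (max (‖c‖ - w) 0) ^ 2)) * (∫⁻ y in ball c w, H y) +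
        B * ENNReal.ofReal (2 * ρ) * volume (ball (0 : ℝ²) ρ) := by
  rw [lintegral_ball_comp_projXY H hH hρ, ← lintegral_add_compl _ (measurableSet_ball (x := c) (ε := w))]
  apply add_le_add
  · -- near part
    rw [← lintegral_const_mul' _ _ ENNReal.ofReal_ne_top]
    refine setLIntegral_mono' measurableSet_ball fun y hy => ?_
    rw [mul_comm]
    refine mul_le_mul' (ENNReal.ofReal_le_ofReal ?_) le_rfl
    rcases le_or_gt (‖c‖ - w) 0 with hcw | hcw
    · rw [max_eq_right hcw]
      have := chord_le hρ.le y
      simpa [Real.sqrt_sq hρ.le] using this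
    · rw [max_eq_left hcw.le]
      refine chord_le_of_le_norm ?_ hcw.le
      have : dist y c < w := hy
      have := norm_sub_norm_le c y
      rw [← dist_eq_norm, dist_comm] at this
      linarith
  · -- far part
    calc ∫⁻ y in (ball c w)ᶜ, H y * ENNReal.ofReal (chord ρ y)
        ≤ ∫⁻ y in (ball c w)ᶜ, (ball (0 : ℝ²) ρ).indicator (fun _ => B * ENNReal.ofReal (2 * ρ)) y := by
          refine setLIntegral_mono' (measurableSet_ball.compl) fun y hy => ?_
          by_cases hyρ : y ∈ ball (0 : ℝ²) ρ
          · rw [indicator_of_mem hyρ]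
            exact mul_le_mul' (hB y hy) (ENNReal.ofReal_le_ofReal (chord_le hρ.le y))
          · rw [indicator_of_notMem hyρ, chord_eq_zero (by simpa using hyρ) hρ.le, ENNReal.ofReal_zero,
              mul_zero]
      _ ≤ ∫⁻ y, (ball (0 : ℝ²) ρ).indicator (fun _ => B * ENNReal.ofReal (2 * ρ)) y :=
          setLIntegral_le_lintegral _ _
      _ = B * ENNReal.ofReal (2 * ρ) * volume (ball (0 : ℝ²) ρ) := by
          rw [lintegral_indicator_const measurableSet_ball]

/-- **Time Tonelli on the parabolic cylinder** `Q_ρ(0,0) = (−ρ², 0) × B_ρ`. [folklore] -/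
theorem lintegral_parabolicCylinder (g : ℝ × ℝ³ → ℝ≥0∞) (hg : Measurable g) (ρ : ℝ) :
    ∫⁻ q in parabolicCylinder ρ (0 : ℝ × ℝ³), g q =
      ∫⁻ t in Ioo (-ρ ^ 2) 0, ∫⁻ x in ball (0 : ℝ³) ρ, g (t, x) := by
  have hQ : parabolicCylinder ρ (0 : ℝ × ℝ³) = Ioo (-ρ ^ 2) 0 ×ˢ ball (0 : ℝ³) ρ := by
    rw [parabolicCylinder]; simp
  rw [hQ, Measure.volume_eq_prod, ← Measure.prod_restrict, lintegral_prod _ hg.aemeasurable]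

/-- Translating a disc integral to the origin. [folklore] -/
theorem lintegral_ball_sub (f : ℝ² → ℝ≥0∞) (c : ℝ²) (w : ℝ) :
    ∫⁻ y in ball c w, f (y - c) = ∫⁻ η in ball (0 : ℝ²) w, f η := by
  rw [← lintegral_indicator measurableSet_ball, ← lintegral_indicator measurableSet_ball]
  have h : ∀ y : ℝ², (ball c w).indicator (fun y => f (y - c)) y =
      (ball (0 : ℝ²) w).indicator f (y - c) := by
    intro y
    by_cases hy : y ∈ ball c w
    · have hy' : y - c ∈ ball (0 : ℝ²) w := by simpa [mem_ball, dist_eq_norm] using hy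
      rw [indicator_of_mem hy, indicator_of_mem hy']
    · have hy' : y - c ∉ ball (0 : ℝ²) w := by simpa [mem_ball, dist_eq_norm] using hy
      rw [indicator_of_notMem hy, indicator_of_notMem hy']
  simp_rw [h]
  exact lintegral_sub_right_eq_self (μ := volume) ((ball (0 : ℝ²) w).indicator f) c

end Summit.NavierStokesRegularity.NavierStokesRegularity.Theorems.Schatz2025
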